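import Literature.Geometry.Lorentzian.CoordGlobalGardingPointwise
import Literature.Geometry.Lorentzian.CoordBoundaryCoercivityCompact
import Literature.Geometry.Lorentzian.CoordInteriorGarding
import HarnessLib

/-!
# The global weighted Gårding inequality for the KID operator (Chruściel–Delay 2003, Prop. 3.3)

Topic `Literature/Geometry/Lorentzian`, coordinate tensor calculus `MetricCoord`. Everything here is
PROVED; no definition and no statement of `Prop` type is introduced.

Setting: Riemannian metric components `G` on an open `V` (`dim ≠ 1`), a smooth field `K` of
symmetric forms, a smooth function `x` on `V`; the DOMAIN is `M = {y ∈ V | 0 < x}`, assumed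
relatively compact in `V` (`M ⊆ C`, `C ⊆ V` compact), with a compact collar
`{0 < x < x₁} ⊆ C₁ ⊆ V` on which `dx ≠ 0` (the setting of a compact manifold with boundary
`M̄ ⊂ V`, `x` a boundary defining function). Weights `ψ = e^{σ/x}`, `φ = x²`, `Φ = diag(x², x⁴)`.

* **`IsMetricOn.globalWeightedGarding`** — for every `σ > 0` there is `A` such that for all
  `N, Y` smooth on `V` with compact support in `M`,
  `‖Y‖²_{H̊¹_{φ,ψ}} + ‖N‖²_{H̊²_{φ,ψ}}`
  ` = ∫ √g e^{2σ/x}(|Y|² + x⁴Q(∇Y) + N² + x⁴|∇N|² + x⁸|Hess N|²)`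
  ` ≤ A (∫ √g e^{2σ/x}(x⁴|R_K|² + x⁸|R_G|²) + ∫ √g (N² + |Y|² + |∇N|²))`,
  `R_K = adjHamK N + adjMomKS Y`, `R_G = adjHamG N + adjMomGS Y` the rows of the KID operator `P*`:
  the weighted norm of `(Y, N)` is controlled by `‖ΦP*(Y,N)‖_{L²_ψ}` up to an UNWEIGHTED
  lower-order term. This is the deterministic half of Chruściel–Delay's Prop. 3.3 ((3.4) near
  the boundary + the interior elliptic estimate, glued with a cut-off); the remaining half —
  removing the lower-order term when `P*` has no kernel (no KIDs) by Rellich compactness, which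
  gives (3.5) — is not done here. Since `e^{2σ/x} → ∞` at `∂M`, the lower-order term is a compact
  perturbation of the left-hand side.

Proof: split `(N, Y) = (χN, χY) + ((1−χ)N, (1−χ)Y)` with the collar cut-off of
`CoordCoercivityCutoff.lean`; `IsMetricOn.boundaryCoercivity_of_isCompact_full` bounds the first
piece, `IsMetricOn.interiorGarding` (on `M`, where the weights are comparable to constants on the
support of `1 − χ`) the second; the commutators `[P*, χ]` are of order `≤ 1` with coefficients
supported in `{x₀/2 ≤ x ≤ 3x₀/4}` (`CoordKIDRowsCutoff.lean`, `CoordGlobalGardingPointwise.lean`).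

## References

* P. T. Chruściel, E. Delay, Mém. Soc. Math. Fr. 94 (2003), §3, Prop. 3.1/3.3 and their proofs,
  (2.14), (3.4), (3.5). [ChruscielDelay2003]
-/

noncomputable section

set_option maxSynthPendingDepth 3

open Set Filter Module Function MeasureTheory
open scoped Topology ContDiff

namespace Literature.Geometry.Lorentzian

namespace MetricCoord

variable {E : Type*} [NormedAddCommGroup E] [NormedSpace ℝ E] [FiniteDimensional ℝ E]
  [CompleteSpace E] {ι : Type*} [Fintype ι] [DecidableEq ι] (b : Basis ι ℝ E)
  {G : E → E →L[ℝ] E →L[ℝ] ℝ} {V : Set E} {K : E → E →L[ℝ] E →L[ℝ] ℝ} {xf : E → ℝ}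
  [MeasurableSpace E] [BorelSpace E] (μ : Measure E) [μ.IsAddHaarMeasure]

set_option maxHeartbeats 3200000 in
/-- **The global weighted Gårding inequality** (Chruściel–Delay 2003, the deterministic half of
Prop. 3.3). Let `G` be Riemannian metric components on `V` (`dim ≠ 1`), `K` a smooth field of
symmetric forms on `V`, `x` smooth on `V`; suppose the collar `{y ∈ V | 0 < x < x₁}` lies in a
compact `C₁ ⊆ V` on which `∇x ≠ 0`, and the domain `M = {y ∈ V | 0 < x}` lies in a compact
`C ⊆ V`. Then for every `σ > 0` there is `A` such that for all `N, Y` smooth on `V` with compact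
support in `M`,
`∫ √g e^{2σ/x}(|Y|² + x⁴Q(∇Y)) + ∫ √g e^{2σ/x}(N² + x⁴|∇N|² + x⁸|Hess N|²)`
`  ≤ A (∫ √g e^{2σ/x}x⁴|R_K|² + ∫ √g e^{2σ/x}x⁸|R_G|² + ∫ √g N² + ∫ √g |Y|² + ∫ √g |∇N|²)`,
i.e. `‖Y‖_{H̊¹_{φ,ψ}} + ‖N‖_{H̊²_{φ,ψ}} ≤ C(‖ΦP*(Y,N)‖_{L²_ψ} + ‖Y‖_{L²} + ‖N‖_{H¹})`.
[cite: ChruscielDelay2003, Prop. 3.3 (proof), (2.14), (3.4)] -/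
theorem IsMetricOn.globalWeightedGarding (hG : IsMetricOn G V)
    (hpos : ∀ y ∈ V, ∀ e : E, e ≠ 0 → 0 < G y e e) (hn : finrank ℝ E ≠ 1)
    (hK : ContDiffOn ℝ ∞ K V) (hKs : ∀ y ∈ V, ∀ v w, K y v w = K y w v)
    (hxf : ContDiffOn ℝ ∞ xf V) {x₁ : ℝ} (hx₁ : 0 < x₁) {C₁ : Set E} (hC₁ : IsCompact C₁)
    (hC₁V : C₁ ⊆ V) (hcol : {y ∈ V | 0 < xf y ∧ xf y < x₁} ⊆ C₁)
    (hdx : ∀ y ∈ C₁, gradSqAt G xf y ≠ 0)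
    {C : Set E} (hC : IsCompact C) (hCV : C ⊆ V) (hMC : {y ∈ V | 0 < xf y} ⊆ C)
    {σ : ℝ} (hσ : 0 < σ) :
    ∃ A : ℝ, ∀ (N : E → ℝ) (Y : E → E), ContDiffOn ℝ ∞ N V → ContDiffOn ℝ ∞ Y V →
      HasCompactSupport N → HasCompactSupport Y →
      tsupport N ⊆ {y ∈ V | 0 < xf y} → tsupport Y ⊆ {y ∈ V | 0 < xf y} →
      ∫ y, sqrtDetGram G b y * (Real.exp (2 * σ / xf y) * G y (Y y) (Y y)) ∂μ
        + ∫ y, sqrtDetGram G b y * (Real.exp (2 * σ / xf y) * xf y ^ 4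
            * mtrAt G y ((G y).bilinearComp (covDAt G Y y) (covDAt G Y y))) ∂μ
        + ∫ y, sqrtDetGram G b y * (Real.exp (2 * σ / xf y) * N y ^ 2) ∂μ
        + ∫ y, sqrtDetGram G b y * (Real.exp (2 * σ / xf y) * xf y ^ 4 * gradSqAt G N y) ∂μ
        + ∫ y, sqrtDetGram G b y * (Real.exp (2 * σ / xf y) * xf y ^ 8
            * normSqAt G y (hessAt G N y)) ∂μ ≤
      A * (∫ y, sqrtDetGram G b y * (Real.exp (2 * σ / xf y) * xf y ^ 4
              * normSqAt G y (adjHamK G K N y + adjMomKS G Y y)) ∂μ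
          + ∫ y, sqrtDetGram G b y * (Real.exp (2 * σ / xf y) * xf y ^ 8
              * normSqAt G y (adjHamG G K N y + adjMomGS G K Y y)) ∂μ
          + ∫ y, sqrtDetGram G b y * N y ^ 2 ∂μ
          + ∫ y, sqrtDetGram G b y * G y (Y y) (Y y) ∂μ
          + ∫ y, sqrtDetGram G b y * gradSqAt G N y ∂μ) := by
  /- ── Step 0: the boundary estimate, the cut-off ─────────────────────────────────────── -/
  obtain ⟨x₀, hx₀, A₀, hbdry⟩ := hG.boundaryCoercivity_of_isCompact_full b μ hpos hn hK hKs hxf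
    hx₁ hC₁ hC₁V hcol hdx hσ
  obtain ⟨χ, hχs, hχ01, hχ1, hχ0, hχ1n, hχ0n⟩ := exists_collarCutoff hG.isOpen hxf hx₀
  have hχs' : ContDiffOn ℝ ∞ (fun z ↦ 1 - χ z) V := contDiffOn_const.sub hχs
  /- ── Step 1: constants by compactness on `C` ────────────────────────────────────────── -/
  have cont : ∀ {f : E → ℝ}, ContDiffOn ℝ ∞ f V → ContinuousOn f C := fun hf ↦
    hf.continuousOn.mono hCV
  have habs : ∀ {r B : ℝ}, ‖r‖ ≤ B → r ≤ max B 0 := fun {r B} h ↦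
    ((le_abs_self r).trans (Real.norm_eq_abs r ▸ h)).trans (le_max_left _ _)
  have habs' : ∀ {r B : ℝ}, ‖r‖ ≤ B → |r| ≤ max B 0 := fun {r B} h ↦
    (show |r| ≤ B from Real.norm_eq_abs r ▸ h).trans (le_max_left _ _)
  -- `x ≤ X` on `C`, `X ≥ 1`
  obtain ⟨BX, hBX⟩ := hC.exists_bound_of_continuousOn (cont hxf)
  set X : ℝ := max BX 1 with hXdef
  have hX1 : 1 ≤ X := le_max_right _ _
  have hX0 : 0 ≤ X := zero_le_one.trans hX1
  have hxX : ∀ y ∈ C, xf y ≤ X := fun y hy ↦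
    ((le_abs_self _).trans (Real.norm_eq_abs (xf y) ▸ hBX y hy)).trans (le_max_left _ _)
  -- geometry/data bounds (as in `boundaryCoercivity_of_isCompact`)
  have hricC := cont (hG.contDiffOn_normSqAt hG.contDiffOn_ricAt)
  have hKK : ContDiffOn ℝ ∞ (fun y ↦ (K y).comp ((sharpAt G y).comp (K y))) V :=
    hK.clm_comp (hG.contDiffOn_sharpAt.clm_comp hK)
  have htrK : ContDiffOn ℝ ∞ (fun y ↦ mtrAt G y (K y)) V := hG.contDiffOn_mtrAt hK
  have hWf : ContDiffOn ℝ ∞ (fun y ↦ normSqAt G y (mtrAt G y (K y) • G y + (2 : ℝ) • K y)) V :=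
    hG.contDiffOn_normSqAt ((htrK.smul hG.contDiffOn).add (hK.const_smul (2 : ℝ)))
  have hZf : ContDiffOn ℝ ∞ (fun y ↦ normSqAt G y (ricAt G y
      - (2 : ℝ) • (K y).comp ((sharpAt G y).comp (K y))
      + (2 * mtrAt G y (K y)) • K y
      + (((finrank ℝ E : ℝ) - 1)⁻¹ * (-scalAt G y
          + 2 * mtrAt G y ((K y).comp ((sharpAt G y).comp (K y)))
          - 2 * mtrAt G y (K y) ^ 2)) • G y)) V := by
    refine hG.contDiffOn_normSqAt ?_
    have h1 : ContDiffOn ℝ ∞ (fun y ↦ (2 * mtrAt G y (K y)) • K y) V :=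
      (contDiffOn_const.mul htrK).smul hK
    have h2 : ContDiffOn ℝ ∞ (fun y ↦ ((finrank ℝ E : ℝ) - 1)⁻¹ * (-scalAt G y
        + 2 * mtrAt G y ((K y).comp ((sharpAt G y).comp (K y))) - 2 * mtrAt G y (K y) ^ 2)) V :=
      contDiffOn_const.mul (((hG.contDiffOn_scalAt.neg).add
        (contDiffOn_const.mul (hG.contDiffOn_mtrAt hKK))).sub (contDiffOn_const.mul (htrK.pow 2)))
    exact ((hG.contDiffOn_ricAt.sub (hKK.const_smul (2 : ℝ))).add h1).add (h2.smul hG.contDiffOn)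
  have hcovC : ContinuousOn (fun y ↦ ∑ k, ∑ l, ginv G b y k l
      * pairAt G y (cov₂At G K y (b k)) (cov₂At G K y (b l))) C := by
    refine cont (ContDiffOn.sum fun k _ ↦ ContDiffOn.sum fun l _ ↦ ?_)
    exact (hG.contDiffOn_ginv b k l).mul (hG.contDiffOn_pairAt
      ((hG.contDiffOn_cov₂At hK).clm_apply contDiffOn_const)
      ((hG.contDiffOn_cov₂At hK).clm_apply contDiffOn_const))
  obtain ⟨B₄, hB₄⟩ := hC.exists_bound_of_continuousOn hricC
  obtain ⟨B₅, hB₅⟩ := hC.exists_bound_of_continuousOn (cont hWf)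
  obtain ⟨B₆, hB₆⟩ := hC.exists_bound_of_continuousOn (cont hZf)
  obtain ⟨B₇, hB₇⟩ := hC.exists_bound_of_continuousOn (cont (hG.contDiffOn_normSqAt hK))
  obtain ⟨B₈, hB₈⟩ := hC.exists_bound_of_continuousOn hcovC
  -- cut-off bounds
  obtain ⟨Bg', hBg'⟩ := hC.exists_bound_of_continuousOn (cont (hG.contDiffOn_gradSqAt hχs))
  obtain ⟨Bl', hBl'⟩ := hC.exists_bound_of_continuousOn (cont (hG.contDiffOn_lapAt hχs))
  obtain ⟨Bh', hBh'⟩ := hC.exists_bound_of_continuousOn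
    (cont (hG.contDiffOn_normSqAt (hG.contDiffOn_hessAt hχs)))
  obtain ⟨Bl₂', hBl₂'⟩ := hC.exists_bound_of_continuousOn (cont (hG.contDiffOn_lapAt hχs'))
  obtain ⟨Bh₂', hBh₂'⟩ := hC.exists_bound_of_continuousOn
    (cont (hG.contDiffOn_normSqAt (hG.contDiffOn_hessAt hχs')))
  set ρ : ℝ := Real.sqrt (max B₄ 0) with hρdef
  set w₁ : ℝ := max B₅ 0 with hw₁def
  set z₁ : ℝ := max B₆ 0 with hz₁def
  set k₁ : ℝ := max B₇ 0 with hk₁def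
  set k₂ : ℝ := max B₈ 0 with hk₂def
  set Bg : ℝ := max Bg' 0 with hBgdef
  set Bl : ℝ := max Bl' 0 with hBldef
  set Bh : ℝ := max Bh' 0 with hBhdef
  set Bl₂ : ℝ := max Bl₂' 0 with hBl₂def
  set Bh₂ : ℝ := max Bh₂' 0 with hBh₂def
  have hρ0 : 0 ≤ ρ := Real.sqrt_nonneg _
  have hw₁0 : 0 ≤ w₁ := le_max_right _ _
  have hz₁0 : 0 ≤ z₁ := le_max_right _ _
  have hk₁0 : 0 ≤ k₁ := le_max_right _ _
  have hk₂0 : 0 ≤ k₂ := le_max_right _ _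
  have hBg0 : 0 ≤ Bg := le_max_right _ _
  have hBh0 : 0 ≤ Bh := le_max_right _ _
  have hBgb : ∀ y ∈ C, gradSqAt G χ y ≤ Bg := fun y hy ↦ habs (hBg' y hy)
  have hBlb : ∀ y ∈ C, |lapAt G χ y| ≤ Bl := fun y hy ↦ habs' (hBl' y hy)
  have hBhb : ∀ y ∈ C, normSqAt G y (hessAt G χ y) ≤ Bh := fun y hy ↦ habs (hBh' y hy)
  have hBl₂b : ∀ y ∈ C, |lapAt G (fun z ↦ 1 - χ z) y| ≤ Bl₂ := fun y hy ↦ habs' (hBl₂' y hy)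
  have hBh₂b : ∀ y ∈ C, normSqAt G y (hessAt G (fun z ↦ 1 - χ z) y) ≤ Bh₂ := fun y hy ↦
    habs (hBh₂' y hy)
  have hk₁b : ∀ y ∈ C, normSqAt G y (K y) ≤ k₁ := fun y hy ↦ habs (hB₇ y hy)
  /- ── Step 2: the interior estimate on `M' = {0 < x < X + 1} ⊇ M` ───────────────────── -/
  set M' : Set E := {y ∈ V | 0 < xf y ∧ xf y < X + 1} with hM'def
  have hMM' : {y ∈ V | 0 < xf y} ⊆ M' := fun y hy ↦
    ⟨hy.1, hy.2, (hxX y (hMC hy)).trans_lt (lt_add_one X)⟩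
  have hM'C : M' ⊆ C := fun y hy ↦ hMC ⟨hy.1, hy.2.1⟩
  have hM'V : M' ⊆ V := fun y hy ↦ hy.1
  have hGM : IsMetricOn G M' := hG.collar hxf (X + 1)
  obtain ⟨CB, hint⟩ := hGM.interiorGarding b μ (fun y hy e he ↦ hpos y hy.1 e he) hn
    (hK.mono hM'V) (fun y hy ↦ hKs y hy.1) (ρ := ρ) (w₁ := w₁) (z₁ := z₁) (k₁ := k₁) (k₂ := k₂)
    hρ0 hw₁0 hz₁0 hk₁0 hk₂0
    (fun y hy v ↦ by
      have hyV := hy.1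
      refine (le_abs_self _).trans
        ((abs_apply_le_sqrt_normSqAt_mul hG hyV (hpos y hyV) (ricAt G y) v).trans ?_)
      have hv : 0 ≤ G y v v := by
        by_cases hz : v = 0
        · simp [hz]
        · exact (hpos y hyV _ hz).le
      exact mul_le_mul_of_nonneg_right (Real.sqrt_le_sqrt (habs (hB₄ y (hM'C hy)))) hv)
    (fun y hy ↦ habs (hB₅ y (hM'C hy))) (fun y hy ↦ habs (hB₆ y (hM'C hy)))
    (fun y hy ↦ habs (hB₇ y (hM'C hy))) (fun y hy ↦ habs (hB₈ y (hM'C hy)))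
  /- ── Step 3: the constant ───────────────────────────────────────────────────────────── -/
  have hn0 : 0 ≤ (finrank ℝ E : ℝ) := Nat.cast_nonneg _
  -- weights on the interior piece (opaque names with defining equations, rewritten explicitly)
  obtain ⟨eW, heW⟩ : ∃ c : ℝ, c = Real.exp (4 * σ / x₀) := ⟨_, rfl⟩
  obtain ⟨W4, hW4⟩ : ∃ c : ℝ, c = Real.exp (4 * σ / x₀) * X ^ 4 := ⟨_, rfl⟩
  obtain ⟨W8, hW8⟩ : ∃ c : ℝ, c = Real.exp (4 * σ / x₀) * X ^ 8 := ⟨_, rfl⟩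
  have heW0 : 0 ≤ eW := by rw [heW]; exact Real.exp_nonneg _
  have hW40 : 0 ≤ W4 := by rw [hW4]; positivity
  have hW80 : 0 ≤ W8 := by rw [hW8]; positivity
  have hX4 : 1 ≤ X ^ 4 := one_le_pow₀ hX1
  have hX48 : X ^ 4 ≤ X ^ 8 := pow_le_pow_right₀ hX1 (by norm_num)
  have heW4 : eW ≤ W4 := by
    rw [heW, hW4]; exact le_mul_of_one_le_right (Real.exp_nonneg _) hX4
  have hW48 : W4 ≤ W8 := by
    rw [hW4, hW8]; exact mul_le_mul_of_nonneg_left hX48 (Real.exp_nonneg _)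
  set A₀' : ℝ := max A₀ 0 with hA₀'
  set CB' : ℝ := max CB 0 with hCB'
  have hA₀'0 : 0 ≤ A₀' := le_max_right _ _
  have hCB'0 : 0 ≤ CB' := le_max_right _ _
  -- coefficients of the commutator bounds (written exactly as the pointwise lemmas produce them)
  obtain ⟨cK, hcK⟩ : ∃ c : ℝ,
      c = 4 * (1 + (finrank ℝ E : ℝ)) * Real.exp (4 * σ / x₀) * X ^ 4 * Bg := ⟨_, rfl⟩
  obtain ⟨cG1, hcG1⟩ : ∃ c : ℝ,
      c = 8 * (Real.exp (4 * σ / x₀) * X ^ 8) * (2 * (finrank ℝ E : ℝ) * Bl ^ 2 + Bh) := ⟨_, rfl⟩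
  obtain ⟨cG2, hcG2⟩ : ∃ c : ℝ,
      c = 8 * (Real.exp (4 * σ / x₀) * X ^ 8) * (8 * (finrank ℝ E : ℝ) + 4) * Bg := ⟨_, rfl⟩
  obtain ⟨cG3, hcG3⟩ : ∃ c : ℝ,
      c = 6 * (Real.exp (4 * σ / x₀) * X ^ 8) * (5 + (finrank ℝ E : ℝ)) * Bg * k₁ := ⟨_, rfl⟩
  obtain ⟨cx4, hcx4⟩ : ∃ c : ℝ, c = 2 * (2 / x₀) ^ 4 := ⟨_, rfl⟩
  obtain ⟨cx8, hcx8⟩ : ∃ c : ℝ, c = 2 * (2 / x₀) ^ 8 := ⟨_, rfl⟩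
  obtain ⟨dK, hdK⟩ : ∃ c : ℝ, c = 4 * (1 + (finrank ℝ E : ℝ)) * Bg := ⟨_, rfl⟩
  obtain ⟨dG1, hdG1⟩ : ∃ c : ℝ, c = 8 * (2 * (finrank ℝ E : ℝ) * Bl₂ ^ 2 + Bh₂) := ⟨_, rfl⟩
  obtain ⟨dG2, hdG2⟩ : ∃ c : ℝ, c = 8 * (8 * (finrank ℝ E : ℝ) + 4) * Bg := ⟨_, rfl⟩
  obtain ⟨dG3, hdG3⟩ : ∃ c : ℝ, c = 6 * (5 + (finrank ℝ E : ℝ)) * Bg * k₁ := ⟨_, rfl⟩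
  have hBh₂0 : 0 ≤ Bh₂ := le_max_right _ _
  have hcK0 : 0 ≤ cK := by rw [hcK]; positivity
  have hcG10 : 0 ≤ cG1 := by rw [hcG1]; positivity
  have hcG20 : 0 ≤ cG2 := by rw [hcG2]; positivity
  have hcG30 : 0 ≤ cG3 := by rw [hcG3]; positivity
  have hcx40 : 0 ≤ cx4 := by rw [hcx4]; positivity
  have hcx80 : 0 ≤ cx8 := by rw [hcx8]; positivity
  have hdK0 : 0 ≤ dK := by rw [hdK]; positivity
  have hdG10 : 0 ≤ dG1 := by rw [hdG1]; positivity
  have hdG20 : 0 ≤ dG2 := by rw [hdG2]; positivity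
  have hdG30 : 0 ≤ dG3 := by rw [hdG3]; positivity
  obtain ⟨c1, hc1⟩ : ∃ c : ℝ, c = 2 + 2 + cK + cG1 + cG2 + cG3 := ⟨_, rfl⟩
  obtain ⟨c2, hc2⟩ : ∃ c : ℝ, c = cx4 + cx8 + dK + dG1 + dG2 + dG3 + 1 + 1 := ⟨_, rfl⟩
  have hc10 : 0 ≤ c1 := by rw [hc1]; positivity
  have hc20 : 0 ≤ c2 := by rw [hc2]; positivity
  refine ⟨2 * (A₀' * c1) + 2 * (eW + eW) + 2 * (W8 * (CB' * c2)),
    fun N Y hN hY hNs hYs hNS hYS ↦ ?_⟩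
  /- ── Step 6: notation for the quantities ────────────────────────────────────────────── -/
  -- the pair
  set wYy := ∫ y, sqrtDetGram G b y * (Real.exp (2 * σ / xf y) * G y (Y y) (Y y)) ∂μ with hwYy
  set wQq := ∫ y, sqrtDetGram G b y * (Real.exp (2 * σ / xf y) * xf y ^ 4
    * mtrAt G y ((G y).bilinearComp (covDAt G Y y) (covDAt G Y y))) ∂μ with hwQq
  set wNn := ∫ y, sqrtDetGram G b y * (Real.exp (2 * σ / xf y) * N y ^ 2) ∂μ with hwNn
  set wD := ∫ y, sqrtDetGram G b y * (Real.exp (2 * σ / xf y) * xf y ^ 4 * gradSqAt G N y) ∂μ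
    with hwD
  set wH := ∫ y, sqrtDetGram G b y * (Real.exp (2 * σ / xf y) * xf y ^ 8
    * normSqAt G y (hessAt G N y)) ∂μ with hwH
  set wRK := ∫ y, sqrtDetGram G b y * (Real.exp (2 * σ / xf y) * xf y ^ 4
    * normSqAt G y (adjHamK G K N y + adjMomKS G Y y)) ∂μ with hwRK
  set wRG := ∫ y, sqrtDetGram G b y * (Real.exp (2 * σ / xf y) * xf y ^ 8
    * normSqAt G y (adjHamG G K N y + adjMomGS G K Y y)) ∂μ with hwRG
  set Nn := ∫ y, sqrtDetGram G b y * N y ^ 2 ∂μ with hNn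
  set Yy := ∫ y, sqrtDetGram G b y * G y (Y y) (Y y) ∂μ with hYy
  set Dg := ∫ y, sqrtDetGram G b y * gradSqAt G N y ∂μ with hDg
  -- piece 1
  set wYy₁ := ∫ y, sqrtDetGram G b y * (Real.exp (2 * σ / xf y)
    * G y (χ y • Y y) (χ y • Y y)) ∂μ with hwYy₁
  set wQq₁ := ∫ y, sqrtDetGram G b y * (Real.exp (2 * σ / xf y) * xf y ^ 4
    * mtrAt G y ((G y).bilinearComp (covDAt G (fun z ↦ χ z • Y z) y)
      (covDAt G (fun z ↦ χ z • Y z) y))) ∂μ with hwQq₁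
  set wNn₁ := ∫ y, sqrtDetGram G b y * (Real.exp (2 * σ / xf y)
    * (χ y * N y) ^ 2) ∂μ with hwNn₁
  set wD₁ := ∫ y, sqrtDetGram G b y * (Real.exp (2 * σ / xf y) * xf y ^ 4
    * gradSqAt G (fun z ↦ χ z * N z) y) ∂μ with hwD₁
  set wH₁ := ∫ y, sqrtDetGram G b y * (Real.exp (2 * σ / xf y) * xf y ^ 8
    * normSqAt G y (hessAt G (fun z ↦ χ z * N z) y)) ∂μ with hwH₁
  set wRK₁ := ∫ y, sqrtDetGram G b y * (Real.exp (2 * σ / xf y) * xf y ^ 4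
    * normSqAt G y (adjHamK G K (fun z ↦ χ z * N z) y + adjMomKS G (fun z ↦ χ z • Y z) y)) ∂μ
    with hwRK₁
  set wRG₁ := ∫ y, sqrtDetGram G b y * (Real.exp (2 * σ / xf y) * xf y ^ 8
    * normSqAt G y (adjHamG G K (fun z ↦ χ z * N z) y + adjMomGS G K (fun z ↦ χ z • Y z) y)) ∂μ
    with hwRG₁
  -- piece 2
  set wYy₂ := ∫ y, sqrtDetGram G b y * (Real.exp (2 * σ / xf y)
    * G y ((1 - χ y) • Y y) ((1 - χ y) • Y y)) ∂μ with hwYy₂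
  set wQq₂ := ∫ y, sqrtDetGram G b y * (Real.exp (2 * σ / xf y) * xf y ^ 4
    * mtrAt G y ((G y).bilinearComp (covDAt G (fun z ↦ (1 - χ z) • Y z) y)
      (covDAt G (fun z ↦ (1 - χ z) • Y z) y))) ∂μ with hwQq₂
  set wNn₂ := ∫ y, sqrtDetGram G b y * (Real.exp (2 * σ / xf y)
    * ((1 - χ y) * N y) ^ 2) ∂μ with hwNn₂
  set wD₂ := ∫ y, sqrtDetGram G b y * (Real.exp (2 * σ / xf y) * xf y ^ 4
    * gradSqAt G (fun z ↦ (1 - χ z) * N z) y) ∂μ with hwD₂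
  set wH₂ := ∫ y, sqrtDetGram G b y * (Real.exp (2 * σ / xf y) * xf y ^ 8
    * normSqAt G y (hessAt G (fun z ↦ (1 - χ z) * N z) y)) ∂μ with hwH₂
  set Q₂ := ∫ y, sqrtDetGram G b y * mtrAt G y ((G y).bilinearComp
    (covDAt G (fun z ↦ (1 - χ z) • Y z) y) (covDAt G (fun z ↦ (1 - χ z) • Y z) y)) ∂μ with hQ₂
  set Hs₂ := ∫ y, sqrtDetGram G b y * normSqAt G y (hessAt G (fun z ↦ (1 - χ z) * N z) y) ∂μ
    with hHs₂
  set Dg₂ := ∫ y, sqrtDetGram G b y * gradSqAt G (fun z ↦ (1 - χ z) * N z) y ∂μ with hDg₂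
  set RK₂ := ∫ y, sqrtDetGram G b y * normSqAt G y (adjHamK G K (fun z ↦ (1 - χ z) * N z) y
    + adjMomKS G (fun z ↦ (1 - χ z) • Y z) y) ∂μ with hRK₂
  set RG₂ := ∫ y, sqrtDetGram G b y * normSqAt G y (adjHamG G K (fun z ↦ (1 - χ z) * N z) y
    + adjMomGS G K (fun z ↦ (1 - χ z) • Y z) y) ∂μ with hRG₂
  set Nn₂ := ∫ y, sqrtDetGram G b y * ((1 - χ y) * N y) ^ 2 ∂μ with hNn₂
  set Yy₂ := ∫ y, sqrtDetGram G b y * G y ((1 - χ y) • Y y) ((1 - χ y) • Y y) ∂μ with hYy₂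
  /- ── Step 4: the two pieces ─────────────────────────────────────────────────────────── -/
  -- supports
  set S : Set E := tsupport N ∪ tsupport Y with hSdef
  have hS : IsCompact S := hNs.union hYs
  have hSc : IsClosed S := (isClosed_tsupport N).union (isClosed_tsupport Y)
  have hSM : S ⊆ {y ∈ V | 0 < xf y} := union_subset hNS hYS
  have hSM' : S ⊆ M' := hSM.trans hMM'
  have hSV : S ⊆ V := fun y hy ↦ (hSM hy).1
  have hSCs : S ⊆ C := fun y hy ↦ hMC (hSM hy)
  -- smoothness of the pieces on `V`
  have hN₁ : ContDiffOn ℝ ∞ (fun z ↦ χ z * N z) V := hχs.mul hN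
  have hY₁ : ContDiffOn ℝ ∞ (fun z ↦ χ z • Y z) V := hχs.smul hY
  have hN₂ : ContDiffOn ℝ ∞ (fun z ↦ (1 - χ z) * N z) V := hχs'.mul hN
  have hY₂ : ContDiffOn ℝ ∞ (fun z ↦ (1 - χ z) • Y z) V := hχs'.smul hY
  -- supports of the pieces
  have hN₁S : tsupport (fun z ↦ χ z * N z) ⊆ {y ∈ V | 0 < xf y ∧ xf y < x₀} :=
    tsupport_cutoff_mul_subset_collar hχ0n hNS
  have hY₁S : tsupport (fun z ↦ χ z • Y z) ⊆ {y ∈ V | 0 < xf y ∧ xf y < x₀} :=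
    tsupport_cutoff_smul_subset_collar hχ0n hYS
  have hN₂S : tsupport (fun z ↦ (1 - χ z) * N z) ⊆ M' :=
    (tsupport_cutoff_mul_subset (χ := fun z ↦ 1 - χ z)).trans (hNS.trans hMM')
  have hY₂S : tsupport (fun z ↦ (1 - χ z) • Y z) ⊆ M' :=
    (tsupport_cutoff_smul_subset (χ := fun z ↦ 1 - χ z)).trans (hYS.trans hMM')
  -- the boundary estimate for piece 1 and the interior estimate for piece 2
  have hB := hbdry (fun z ↦ χ z * N z) (fun z ↦ χ z • Y z) hN₁ hY₁
    (hasCompactSupport_cutoff_mul hNs) (hasCompactSupport_cutoff_smul hYs) hN₁S hY₁S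
  have hI := hint (fun z ↦ (1 - χ z) * N z) (fun z ↦ (1 - χ z) • Y z) (hN₂.mono hM'V)
    (hY₂.mono hM'V) (hasCompactSupport_cutoff_mul hNs) (hasCompactSupport_cutoff_smul hYs)
    hN₂S hY₂S
  /- ── Step 5: integrability and vanishing bookkeeping ───────────────────────────────── -/
  -- vanishing off `S`
  have hn0' : ∀ z, normSqAt G z (0 : E →L[ℝ] E →L[ℝ] ℝ) = 0 := fun z ↦ by
    simp [normSqAt_eq_traceCLM]
  have hmtr0 : ∀ z, mtrAt G z ((G z).bilinearComp (0 : E →L[ℝ] E) (0 : E →L[ℝ] E)) = 0 :=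
    fun z ↦ by rw [mtrAt_eq_sum b]; simp
  have van : ∀ {N' : E → ℝ} {Y' : E → E} {z : E}, (N' =ᶠ[𝓝 z] fun _ ↦ 0) →
      (Y' =ᶠ[𝓝 z] fun _ ↦ 0) →
      G z (Y' z) (Y' z) = 0 ∧
      mtrAt G z ((G z).bilinearComp (covDAt G Y' z) (covDAt G Y' z)) = 0 ∧
      N' z ^ 2 = 0 ∧ gradSqAt G N' z = 0 ∧ normSqAt G z (hessAt G N' z) = 0 ∧
      normSqAt G z (adjHamK G K N' z + adjMomKS G Y' z) = 0 ∧
      normSqAt G z (adjHamG G K N' z + adjMomGS G K Y' z) = 0 := by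
    intro N' Y' z hNz hYz
    obtain ⟨hRK, hRG, hcov, -, hhess, -, hN0, hY0⟩ :=
      kidRows_eq_zero_of_eventuallyEq (G := G) (K := K) hNz hYz
    exact ⟨by simp [hY0], by rw [hcov, hmtr0], by simp [hN0],
      gradSqAt_eq_zero_of_eventuallyEq_const hNz, by rw [hhess, hn0'], by rw [hRK, hn0'],
      by rw [hRG, hn0']⟩
  have hzero : ∀ z ∉ S, (N =ᶠ[𝓝 z] fun _ ↦ 0) ∧ (Y =ᶠ[𝓝 z] fun _ ↦ 0) ∧
      ((fun w ↦ χ w * N w) =ᶠ[𝓝 z] fun _ ↦ 0) ∧ ((fun w ↦ χ w • Y w) =ᶠ[𝓝 z] fun _ ↦ 0) ∧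
      ((fun w ↦ (1 - χ w) * N w) =ᶠ[𝓝 z] fun _ ↦ 0) ∧
      ((fun w ↦ (1 - χ w) • Y w) =ᶠ[𝓝 z] fun _ ↦ 0) := by
    intro z hz
    obtain ⟨hNz, hYz⟩ := eventuallyEq_zero_of_notMem_union hz
    exact ⟨hNz, hYz, eventuallyEq_mul_zero_of_right hNz, eventuallyEq_smul_zero_of_right hYz,
      eventuallyEq_mul_zero_of_right hNz, eventuallyEq_smul_zero_of_right hYz⟩
  have van₀ := fun z (hz : z ∉ S) ↦ van (hzero z hz).1 (hzero z hz).2.1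
  have van₁ := fun z (hz : z ∉ S) ↦ van (hzero z hz).2.2.1 (hzero z hz).2.2.2.1
  have van₂ := fun z (hz : z ∉ S) ↦ van (hzero z hz).2.2.2.2.1 (hzero z hz).2.2.2.2.2
  -- smoothness on `V` of the field quantities of a pair
  have smooth : ∀ {N' : E → ℝ} {Y' : E → E}, ContDiffOn ℝ ∞ N' V → ContDiffOn ℝ ∞ Y' V →
      ContDiffOn ℝ ∞ (fun y ↦ G y (Y' y) (Y' y)) V ∧
      ContDiffOn ℝ ∞ (fun y ↦ mtrAt G y ((G y).bilinearComp (covDAt G Y' y) (covDAt G Y' y))) V ∧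
      ContDiffOn ℝ ∞ (fun y ↦ N' y ^ 2) V ∧ ContDiffOn ℝ ∞ (gradSqAt G N') V ∧
      ContDiffOn ℝ ∞ (fun y ↦ normSqAt G y (hessAt G N' y)) V ∧
      ContDiffOn ℝ ∞ (fun y ↦ normSqAt G y (adjHamK G K N' y + adjMomKS G Y' y)) V ∧
      ContDiffOn ℝ ∞ (fun y ↦ normSqAt G y (adjHamG G K N' y + adjMomGS G K Y' y)) V := by
    intro N' Y' hN' hY'
    have hA : ContDiffOn ℝ ∞ (covDAt G Y') V := hG.contDiffOn_covDAt hY'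
    refine ⟨(hG.contDiffOn.clm_apply hY').clm_apply hY', ?_, hN'.pow 2, hG.contDiffOn_gradSqAt hN',
      hG.contDiffOn_normSqAt (hG.contDiffOn_hessAt hN'),
      hG.contDiffOn_normSqAt ((hG.contDiffOn_adjHamK hK hN').add (hG.contDiffOn_adjMomKS hY')),
      hG.contDiffOn_normSqAt ((hG.contDiffOn_adjHamG hK hN').add (hG.contDiffOn_adjMomGS hK hY'))⟩
    have heq : (fun y ↦ mtrAt G y ((G y).bilinearComp (covDAt G Y' y) (covDAt G Y' y))) =
        fun y ↦ ∑ i, ∑ j, ginv G b y i j * G y (covDAt G Y' y (b i)) (covDAt G Y' y (b j)) := by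
      funext y
      rw [mtrAt_eq_sum b]
      simp only [ContinuousLinearMap.bilinearComp_apply]
    rw [heq]
    refine ContDiffOn.sum fun i _ ↦ ContDiffOn.sum fun j _ ↦ ?_
    exact (hG.contDiffOn_ginv b i j).mul
      ((hG.contDiffOn.clm_apply (hA.clm_apply contDiffOn_const)).clm_apply
        (hA.clm_apply contDiffOn_const))
  obtain ⟨sY₀, sQ₀, sN₀, sD₀, sH₀, sRK₀, sRG₀⟩ := smooth hN hY
  obtain ⟨sY₁, sQ₁, sN₁, sD₁, sH₁, sRK₁, sRG₁⟩ := smooth hN₁ hY₁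
  obtain ⟨sY₂, sQ₂, sN₂, sD₂, sH₂, sRK₂, sRG₂⟩ := smooth hN₂ hY₂
  -- weights on `M'`
  have hE : ContDiffOn ℝ ∞ (fun y ↦ Real.exp (2 * σ / xf y)) M' := contDiffOn_expWeight_collar hxf σ _
  have hx4 : ContDiffOn ℝ ∞ (fun y ↦ xf y ^ 4) M' := (hxf.mono hM'V).pow 4
  have hx8 : ContDiffOn ℝ ∞ (fun y ↦ xf y ^ 8) M' := (hxf.mono hM'V).pow 8
  -- integrability
  have hInt : ∀ {k : E → ℝ}, ContDiffOn ℝ ∞ k M' → (∀ z ∉ S, k z = 0) →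
      Integrable (fun z ↦ sqrtDetGram G b z * k z) μ := fun hk hk0 ↦
    hG.integrable_collar b μ hpos hxf hS hSc hSM' hk hk0
  have hIw : ∀ {k : E → ℝ}, ContDiffOn ℝ ∞ k V → (∀ z ∉ S, k z = 0) →
      Integrable (fun z ↦ sqrtDetGram G b z * (Real.exp (2 * σ / xf z) * k z)) μ :=
    fun hk hk0 ↦ hInt (hE.mul (hk.mono hM'V)) fun z hz ↦ by rw [hk0 z hz, mul_zero]
  have hIw4 : ∀ {k : E → ℝ}, ContDiffOn ℝ ∞ k V → (∀ z ∉ S, k z = 0) →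
      Integrable (fun z ↦ sqrtDetGram G b z * (Real.exp (2 * σ / xf z) * xf z ^ 4 * k z)) μ :=
    fun hk hk0 ↦ hInt ((hE.mul hx4).mul (hk.mono hM'V)) fun z hz ↦ by rw [hk0 z hz, mul_zero]
  have hIw8 : ∀ {k : E → ℝ}, ContDiffOn ℝ ∞ k V → (∀ z ∉ S, k z = 0) →
      Integrable (fun z ↦ sqrtDetGram G b z * (Real.exp (2 * σ / xf z) * xf z ^ 8 * k z)) μ :=
    fun hk hk0 ↦ hInt ((hE.mul hx8).mul (hk.mono hM'V)) fun z hz ↦ by rw [hk0 z hz, mul_zero]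
  have hIu : ∀ {k : E → ℝ}, ContDiffOn ℝ ∞ k V → (∀ z ∉ S, k z = 0) →
      Integrable (fun z ↦ sqrtDetGram G b z * k z) μ := fun hk hk0 ↦ hInt (hk.mono hM'V) hk0
  -- piece 0 (the pair itself)
  have IwY₀ := hIw sY₀ fun z hz ↦ (van₀ z hz).1
  have IwQ₀ := hIw4 sQ₀ fun z hz ↦ (van₀ z hz).2.1
  have IwN₀ := hIw sN₀ fun z hz ↦ (van₀ z hz).2.2.1
  have IwD₀ := hIw4 sD₀ fun z hz ↦ (van₀ z hz).2.2.2.1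
  have IwH₀ := hIw8 sH₀ fun z hz ↦ (van₀ z hz).2.2.2.2.1
  have IwRK₀ := hIw4 sRK₀ fun z hz ↦ (van₀ z hz).2.2.2.2.2.1
  have IwRG₀ := hIw8 sRG₀ fun z hz ↦ (van₀ z hz).2.2.2.2.2.2
  have IuN₀ := hIu sN₀ fun z hz ↦ (van₀ z hz).2.2.1
  have IuY₀ := hIu sY₀ fun z hz ↦ (van₀ z hz).1
  have IuD₀ := hIu sD₀ fun z hz ↦ (van₀ z hz).2.2.2.1
  -- piece 1
  have IwY₁ := hIw sY₁ fun z hz ↦ (van₁ z hz).1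
  have IwQ₁ := hIw4 sQ₁ fun z hz ↦ (van₁ z hz).2.1
  have IwN₁ := hIw sN₁ fun z hz ↦ (van₁ z hz).2.2.1
  have IwD₁ := hIw4 sD₁ fun z hz ↦ (van₁ z hz).2.2.2.1
  have IwH₁ := hIw8 sH₁ fun z hz ↦ (van₁ z hz).2.2.2.2.1
  have IwRK₁ := hIw4 sRK₁ fun z hz ↦ (van₁ z hz).2.2.2.2.2.1
  have IwRG₁ := hIw8 sRG₁ fun z hz ↦ (van₁ z hz).2.2.2.2.2.2
  -- piece 2
  have IwY₂ := hIw sY₂ fun z hz ↦ (van₂ z hz).1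
  have IwQ₂ := hIw4 sQ₂ fun z hz ↦ (van₂ z hz).2.1
  have IwN₂ := hIw sN₂ fun z hz ↦ (van₂ z hz).2.2.1
  have IwD₂ := hIw4 sD₂ fun z hz ↦ (van₂ z hz).2.2.2.1
  have IwH₂ := hIw8 sH₂ fun z hz ↦ (van₂ z hz).2.2.2.2.1
  have IuY₂ := hIu sY₂ fun z hz ↦ (van₂ z hz).1
  have IuQ₂ := hIu sQ₂ fun z hz ↦ (van₂ z hz).2.1
  have IuN₂ := hIu sN₂ fun z hz ↦ (van₂ z hz).2.2.1
  have IuD₂ := hIu sD₂ fun z hz ↦ (van₂ z hz).2.2.2.1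
  have IuH₂ := hIu sH₂ fun z hz ↦ (van₂ z hz).2.2.2.2.1
  have IuRK₂ := hIu sRK₂ fun z hz ↦ (van₂ z hz).2.2.2.2.2.1
  have IuRG₂ := hIu sRG₂ fun z hz ↦ (van₂ z hz).2.2.2.2.2.2
  have I0 : Integrable (fun z ↦ sqrtDetGram G b z * (fun _ ↦ (0 : ℝ)) z) μ := by simp
  -- the two estimates in this notation
  have iB : wYy₁ + wQq₁ + wNn₁ + wD₁ + wH₁ ≤ A₀ * (wRK₁ + wRG₁) := hB
  have iI : Q₂ + Hs₂ + Dg₂ ≤ CB * (RK₂ + RG₂ + Nn₂ + Yy₂) := hI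
  /- ── Step 7: pointwise facts at points of `S` ───────────────────────────────────────── -/
  have ptdata : ∀ y ∈ S, y ∈ V ∧ 0 < xf y ∧ xf y ≤ X ∧ y ∈ C := fun y hy ↦
    ⟨(hSM hy).1, (hSM hy).2, hxX y (hSCs hy), hSCs hy⟩
  have hdiff : ∀ {f : E → ℝ} {y : E}, ContDiffOn ℝ ∞ f V → y ∈ V → ContDiffAt ℝ 2 f y :=
    fun hf hy ↦ (hf.contDiffAt (hG.mem_nhds hy)).of_le (by norm_cast)
  have hdiffY : ∀ {Y' : E → E} {y : E}, ContDiffOn ℝ ∞ Y' V → y ∈ V → DifferentiableAt ℝ Y' y :=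
    fun hY' hy ↦ ((hY'.contDiffAt (hG.mem_nhds hy)).differentiableAt (by simp))
  have hKYd : ∀ {y : E}, y ∈ V → DifferentiableAt ℝ (fun z ↦ sharpAt G z (K z (Y z))) y :=
    fun hy ↦ (((hG.contDiffOn_sharpAt.clm_apply (hK.clm_apply hY)).contDiffAt
      (hG.mem_nhds hy)).differentiableAt (by simp))
  /- ── Step 8: the sixteen integral inequalities ──────────────────────────────────────── -/
  have hY0 : ∀ {y : E}, y ∈ V → 0 ≤ G y (Y y) (Y y) := fun {y} hyV ↦ by
    by_cases hz : Y y = 0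
    · simp [hz]
    · exact (hpos y hyV _ hz).le
  have hsq1 : ∀ y, (1 - χ y) ^ 2 ≤ 1 := fun y ↦
    pow_le_one₀ (by linarith [(hχ01 y).2]) (by linarith [(hχ01 y).1])
  -- (s1) splitting
  have s1a : wYy ≤ 2 * wYy₁ + 2 * wYy₂ + 0 * wYy + 0 * wYy := by
    rw [hwYy, hwYy₁, hwYy₂]
    refine integral_sqrtDetGram_le_of_pointwise₄ b μ S 2 2 0 0 IwY₀ IwY₁ IwY₂ IwY₀ IwY₀
      (fun y hy ↦ ?_) (fun y hy ↦ by
        rw [(van₀ y hy).1, (van₁ y hy).1, (van₂ y hy).1]; simp)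
    obtain ⟨hyV, -, -, -⟩ := ptdata y hy
    have h := hG.metric_add_le hyV (hpos y hyV) (χ y • Y y) ((1 - χ y) • Y y)
    have he : χ y • Y y + (1 - χ y) • Y y = Y y := by rw [← add_smul]; simp
    rw [he] at h
    have hw : 0 ≤ Real.exp (2 * σ / xf y) := Real.exp_nonneg _
    calc Real.exp (2 * σ / xf y) * G y (Y y) (Y y)
        ≤ Real.exp (2 * σ / xf y) * (2 * G y (χ y • Y y) (χ y • Y y)
            + 2 * G y ((1 - χ y) • Y y) ((1 - χ y) • Y y)) := mul_le_mul_of_nonneg_left h hw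
      _ = _ := by ring
  have s1b : wQq ≤ 2 * wQq₁ + 2 * wQq₂ + 0 * wQq + 0 * wQq := by
    rw [hwQq, hwQq₁, hwQq₂]
    refine integral_sqrtDetGram_le_of_pointwise₄ b μ S 2 2 0 0 IwQ₀ IwQ₁ IwQ₂ IwQ₀ IwQ₀
      (fun y hy ↦ ?_) (fun y hy ↦ by
        rw [(van₀ y hy).2.1, (van₁ y hy).2.1, (van₂ y hy).2.1]; simp)
    obtain ⟨hyV, hxp, -, -⟩ := ptdata y hy
    have hd₁ := hdiffY hY₁ hyV
    have hd₂ := hdiffY hY₂ hyV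
    have hsum : covDAt G Y y = covDAt G (fun z ↦ χ z • Y z) y
        + covDAt G (fun z ↦ (1 - χ z) • Y z) y := by
      rw [← covDAt_add hd₁ hd₂]
      congr 1
      funext z
      rw [← add_smul]; simp
    have h := hG.mtrAt_bilinearComp_add_le hyV (hpos y hyV) (covDAt G (fun z ↦ χ z • Y z) y)
      (covDAt G (fun z ↦ (1 - χ z) • Y z) y)
    rw [← hsum] at h
    have hw : 0 ≤ Real.exp (2 * σ / xf y) * xf y ^ 4 := by positivity
    calc Real.exp (2 * σ / xf y) * xf y ^ 4
          * mtrAt G y ((G y).bilinearComp (covDAt G Y y) (covDAt G Y y))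
        ≤ Real.exp (2 * σ / xf y) * xf y ^ 4
          * (2 * mtrAt G y ((G y).bilinearComp (covDAt G (fun z ↦ χ z • Y z) y)
              (covDAt G (fun z ↦ χ z • Y z) y))
            + 2 * mtrAt G y ((G y).bilinearComp (covDAt G (fun z ↦ (1 - χ z) • Y z) y)
              (covDAt G (fun z ↦ (1 - χ z) • Y z) y))) := mul_le_mul_of_nonneg_left h hw
      _ = _ := by ring
  have s1c : wNn ≤ 2 * wNn₁ + 2 * wNn₂ + 0 * wNn + 0 * wNn := by
    rw [hwNn, hwNn₁, hwNn₂]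
    refine integral_sqrtDetGram_le_of_pointwise₄ b μ S 2 2 0 0 IwN₀ IwN₁ IwN₂ IwN₀ IwN₀
      (fun y hy ↦ ?_) (fun y hy ↦ by
        rw [(van₀ y hy).2.2.1, (van₁ y hy).2.2.1, (van₂ y hy).2.2.1]; simp)
    have hw : 0 ≤ Real.exp (2 * σ / xf y) := Real.exp_nonneg _
    have h : N y ^ 2 ≤ 2 * (χ y * N y) ^ 2 + 2 * ((1 - χ y) * N y) ^ 2 := by
      have h0 := sq_nonneg (χ y * N y - (1 - χ y) * N y)
      have e : 2 * (χ y * N y) ^ 2 + 2 * ((1 - χ y) * N y) ^ 2 - N y ^ 2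
          = (χ y * N y - (1 - χ y) * N y) ^ 2 := by ring
      linarith
    calc Real.exp (2 * σ / xf y) * N y ^ 2
        ≤ Real.exp (2 * σ / xf y) * (2 * (χ y * N y) ^ 2 + 2 * ((1 - χ y) * N y) ^ 2) :=
          mul_le_mul_of_nonneg_left h hw
      _ = _ := by ring
  have s1d : wD ≤ 2 * wD₁ + 2 * wD₂ + 0 * wD + 0 * wD := by
    rw [hwD, hwD₁, hwD₂]
    refine integral_sqrtDetGram_le_of_pointwise₄ b μ S 2 2 0 0 IwD₀ IwD₁ IwD₂ IwD₀ IwD₀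
      (fun y hy ↦ ?_) (fun y hy ↦ by
        rw [(van₀ y hy).2.2.2.1, (van₁ y hy).2.2.2.1, (van₂ y hy).2.2.2.1]; simp)
    obtain ⟨hyV, hxp, -, -⟩ := ptdata y hy
    have hd₁ := (hdiff hN₁ hyV).differentiableAt (by simp)
    have hd₂ := (hdiff hN₂ hyV).differentiableAt (by simp)
    have h := hG.gradSqAt_add_le hyV (hpos y hyV) hd₁ hd₂
    have he : (fun z ↦ χ z * N z + (1 - χ z) * N z) = N := by funext z; ring
    rw [he] at h
    have hw : 0 ≤ Real.exp (2 * σ / xf y) * xf y ^ 4 := by positivity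
    calc Real.exp (2 * σ / xf y) * xf y ^ 4 * gradSqAt G N y
        ≤ Real.exp (2 * σ / xf y) * xf y ^ 4 * (2 * gradSqAt G (fun z ↦ χ z * N z) y
            + 2 * gradSqAt G (fun z ↦ (1 - χ z) * N z) y) := mul_le_mul_of_nonneg_left h hw
      _ = _ := by ring
  have s1e : wH ≤ 2 * wH₁ + 2 * wH₂ + 0 * wH + 0 * wH := by
    rw [hwH, hwH₁, hwH₂]
    refine integral_sqrtDetGram_le_of_pointwise₄ b μ S 2 2 0 0 IwH₀ IwH₁ IwH₂ IwH₀ IwH₀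
      (fun y hy ↦ ?_) (fun y hy ↦ by
        rw [(van₀ y hy).2.2.2.2.1, (van₁ y hy).2.2.2.2.1, (van₂ y hy).2.2.2.2.1]; simp)
    obtain ⟨hyV, hxp, -, -⟩ := ptdata y hy
    have hsum : hessAt G N y = hessAt G (fun z ↦ χ z * N z) y
        + hessAt G (fun z ↦ (1 - χ z) * N z) y := by
      rw [← hessAt_add G (hdiff hN₁ hyV) (hdiff hN₂ hyV)]
      congr 1
      funext z; ring
    have h := normSqAt_add_le hG hyV (hpos y hyV) (hessAt G (fun z ↦ χ z * N z) y)
      (hessAt G (fun z ↦ (1 - χ z) * N z) y)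
    rw [← hsum] at h
    have hw : 0 ≤ Real.exp (2 * σ / xf y) * xf y ^ 8 := by positivity
    calc Real.exp (2 * σ / xf y) * xf y ^ 8 * normSqAt G y (hessAt G N y)
        ≤ Real.exp (2 * σ / xf y) * xf y ^ 8 * (2 * normSqAt G y (hessAt G (fun z ↦ χ z * N z) y)
            + 2 * normSqAt G y (hessAt G (fun z ↦ (1 - χ z) * N z) y)) :=
          mul_le_mul_of_nonneg_left h hw
      _ = _ := by ring
  -- (s3), (s4): the weighted rows of piece 1
  have s3 : wRK₁ ≤ 2 * wRK + cK * Yy + 0 * wRK + 0 * wRK := by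
    rw [hwRK₁, hwRK, hYy]
    refine integral_sqrtDetGram_le_of_pointwise₄ b μ S 2 cK 0 0 IwRK₁ IwRK₀ IuY₀ IwRK₀ IwRK₀
      (fun y hy ↦ ?_) (fun y hy ↦ by
        rw [(van₁ y hy).2.2.2.2.2.1, (van₀ y hy).2.2.2.2.2.1, (van₀ y hy).1]; simp)
    obtain ⟨hyV, hxp, hxX', hyC⟩ := ptdata y hy
    have h := hG.weighted_kidRowK_cutoff_le hyV (hpos y hyV) hσ.le hx₀ hxp hxX' (hBgb y hyC) hBg0
      (hχ01 y) (hχ1n y hyV) ((hdiff hχs hyV).differentiableAt (by simp)) (hdiffY hY hyV) N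
      (K := K)
    rw [← hcK] at h
    linarith [h]
  have s4 : wRG₁ ≤ 2 * wRG + cG1 * Nn + cG2 * Dg + cG3 * Yy := by
    rw [hwRG₁, hwRG, hNn, hDg, hYy]
    refine integral_sqrtDetGram_le_of_pointwise₄ b μ S 2 cG1 cG2 cG3 IwRG₁ IwRG₀ IuN₀ IuD₀ IuY₀
      (fun y hy ↦ ?_) (fun y hy ↦ by
        rw [(van₁ y hy).2.2.2.2.2.2, (van₀ y hy).2.2.2.2.2.2, (van₀ y hy).2.2.1,
          (van₀ y hy).2.2.2.1, (van₀ y hy).1]; simp)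
    obtain ⟨hyV, hxp, hxX', hyC⟩ := ptdata y hy
    have h := hG.weighted_kidRowG_cutoff_le hyV (hpos y hyV) hσ.le hx₀ hxp hxX' (hBgb y hyC) hBg0
      (hBlb y hyC) (hBhb y hyC) hBh0 (hk₁b y hyC) hk₁0 (hχ01 y) (hχ1n y hyV) (hdiff hχs hyV)
      (hdiff hN hyV) (hdiffY hY hyV) (hKYd hyV)
    rw [← hcG1, ← hcG2, ← hcG3] at h
    exact h
  -- (s6), (s7), (s8): the unweighted quantities of piece 2
  have s6 : RK₂ ≤ cx4 * wRK + dK * Yy + 0 * wRK + 0 * wRK := by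
    rw [hRK₂, hwRK, hYy]
    refine integral_sqrtDetGram_le_of_pointwise₄ b μ S cx4 dK 0 0 IuRK₂ IwRK₀ IuY₀ IwRK₀ IwRK₀
      (fun y hy ↦ ?_) (fun y hy ↦ by
        rw [(van₂ y hy).2.2.2.2.2.1, (van₀ y hy).2.2.2.2.2.1, (van₀ y hy).1]; simp)
    obtain ⟨hyV, hxp, hxX', hyC⟩ := ptdata y hy
    have h := hG.kidRowK_interior_cutoff_le hyV (hpos y hyV) hσ.le hx₀ hxp (hBgb y hyC) (hχ01 y)
      (hχ1 y) ((hdiff hχs hyV).differentiableAt (by simp)) (hdiffY hY hyV) N (K := K)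
    rw [← hcx4, ← hdK] at h
    linarith [h]
  have s7 : RG₂ ≤ cx8 * wRG + dG1 * Nn + dG2 * Dg + dG3 * Yy := by
    rw [hRG₂, hwRG, hNn, hDg, hYy]
    refine integral_sqrtDetGram_le_of_pointwise₄ b μ S cx8 dG1 dG2 dG3 IuRG₂ IwRG₀ IuN₀ IuD₀ IuY₀
      (fun y hy ↦ ?_) (fun y hy ↦ by
        rw [(van₂ y hy).2.2.2.2.2.2, (van₀ y hy).2.2.2.2.2.2, (van₀ y hy).2.2.1,
          (van₀ y hy).2.2.2.1, (van₀ y hy).1]; simp)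
    obtain ⟨hyV, hxp, hxX', hyC⟩ := ptdata y hy
    have h := hG.kidRowG_interior_cutoff_le hyV (hpos y hyV) hσ.le hx₀ hxp (hBgb y hyC) hBg0
      (hBl₂b y hyC) (hBh₂b y hyC) (hk₁b y hyC) (hχ01 y) (hχ1 y) (hdiff hχs hyV)
      (hdiff hN hyV) (hdiffY hY hyV) (hKYd hyV)
    rw [← hcx8, ← hdG1, ← hdG2, ← hdG3] at h
    exact h
  have s8a : Nn₂ ≤ 1 * Nn + 0 * Nn + 0 * Nn + 0 * Nn := by
    rw [hNn₂, hNn]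
    refine integral_sqrtDetGram_le_of_pointwise₄ b μ S 1 0 0 0 IuN₂ IuN₀ IuN₀ IuN₀ IuN₀
      (fun y hy ↦ ?_) (fun y hy ↦ by rw [(van₂ y hy).2.2.1, (van₀ y hy).2.2.1]; simp)
    calc ((1 - χ y) * N y) ^ 2 = (1 - χ y) ^ 2 * N y ^ 2 := by ring
      _ ≤ 1 * N y ^ 2 := mul_le_mul_of_nonneg_right (hsq1 y) (sq_nonneg _)
      _ = _ := by ring
  have s8b : Yy₂ ≤ 1 * Yy + 0 * Yy + 0 * Yy + 0 * Yy := by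
    rw [hYy₂, hYy]
    refine integral_sqrtDetGram_le_of_pointwise₄ b μ S 1 0 0 0 IuY₂ IuY₀ IuY₀ IuY₀ IuY₀
      (fun y hy ↦ ?_) (fun y hy ↦ by rw [(van₂ y hy).1, (van₀ y hy).1]; simp)
    obtain ⟨hyV, -, -, -⟩ := ptdata y hy
    simp only [map_smul, smul_apply, smul_eq_mul]
    calc (1 - χ y) * ((1 - χ y) * G y (Y y) (Y y)) = (1 - χ y) ^ 2 * G y (Y y) (Y y) := by ring
      _ ≤ 1 * G y (Y y) (Y y) := mul_le_mul_of_nonneg_right (hsq1 y) (hY0 hyV)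
      _ = _ := by ring
  -- (s9): the weighted quantities of piece 2 against the unweighted ones
  have s9a : wYy₂ ≤ eW * Yy + 0 * Yy + 0 * Yy + 0 * Yy := by
    rw [hwYy₂, hYy]
    refine integral_sqrtDetGram_le_of_pointwise₄ b μ S eW 0 0 0 IwY₂ IuY₀ IuY₀ IuY₀ IuY₀
      (fun y hy ↦ ?_) (fun y hy ↦ by rw [(van₂ y hy).1, (van₀ y hy).1]; simp)
    obtain ⟨hyV, -, -, -⟩ := ptdata y hy
    have h := weight_interior_sq_le (xf := xf) (y := y) hσ.le hx₀ (hY0 hyV) (hχ01 y) (hχ1 y)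
    rw [← heW] at h
    simp only [map_smul, smul_apply, smul_eq_mul]
    have he : Real.exp (2 * σ / xf y) * ((1 - χ y) * ((1 - χ y) * G y (Y y) (Y y))) =
        Real.exp (2 * σ / xf y) * ((1 - χ y) ^ 2 * G y (Y y) (Y y)) := by ring
    rw [he]
    linarith [h]
  have s9b : wNn₂ ≤ eW * Nn + 0 * Nn + 0 * Nn + 0 * Nn := by
    rw [hwNn₂, hNn]
    refine integral_sqrtDetGram_le_of_pointwise₄ b μ S eW 0 0 0 IwN₂ IuN₀ IuN₀ IuN₀ IuN₀
      (fun y hy ↦ ?_) (fun y hy ↦ by rw [(van₂ y hy).2.2.1, (van₀ y hy).2.2.1]; simp)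
    have h := weight_interior_sq_le (xf := xf) (y := y) hσ.le hx₀ (sq_nonneg (N y)) (hχ01 y)
      (hχ1 y)
    rw [← heW] at h
    have he : ((1 - χ y) * N y) ^ 2 = (1 - χ y) ^ 2 * N y ^ 2 := by ring
    rw [he]
    linarith [h]
  have hvan₂' : ∀ y ∈ S, xf y < x₀ / 2 →
      ((fun w ↦ (1 - χ w) * N w) =ᶠ[𝓝 y] fun _ ↦ 0) ∧
      ((fun w ↦ (1 - χ w) • Y w) =ᶠ[𝓝 y] fun _ ↦ 0) := by
    intro y hy hlt
    have h1 := eventuallyEq_one_sub_zero (hχ1n y (ptdata y hy).1 hlt)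
    exact ⟨eventuallyEq_cutoff_mul_zero h1, eventuallyEq_cutoff_smul_zero h1⟩
  have s9c : wQq₂ ≤ W4 * Q₂ + 0 * Q₂ + 0 * Q₂ + 0 * Q₂ := by
    rw [hwQq₂, hQ₂]
    refine integral_sqrtDetGram_le_of_pointwise₄ b μ S W4 0 0 0 IwQ₂ IuQ₂ IuQ₂ IuQ₂ IuQ₂
      (fun y hy ↦ ?_) (fun y hy ↦ by rw [(van₂ y hy).2.1]; simp)
    obtain ⟨hyV, hxp, hxX', -⟩ := ptdata y hy
    have hq0 : 0 ≤ mtrAt G y ((G y).bilinearComp (covDAt G (fun z ↦ (1 - χ z) • Y z) y)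
        (covDAt G (fun z ↦ (1 - χ z) • Y z) y)) := hG.mtrAt_bilinearComp_nonneg hyV (hpos y hyV) _
    have h := weight_interior_le (xf := xf) (y := y) hσ.le hx₀ hq0 hxp hxX'
      (fun hlt ↦ (van (hvan₂' y hy hlt).1 (hvan₂' y hy hlt).2).2.1) 4
    rw [← hW4] at h
    linarith [h]
  have s9d : wD₂ ≤ W4 * Dg₂ + 0 * Dg₂ + 0 * Dg₂ + 0 * Dg₂ := by
    rw [hwD₂, hDg₂]
    refine integral_sqrtDetGram_le_of_pointwise₄ b μ S W4 0 0 0 IwD₂ IuD₂ IuD₂ IuD₂ IuD₂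
      (fun y hy ↦ ?_) (fun y hy ↦ by rw [(van₂ y hy).2.2.2.1]; simp)
    obtain ⟨hyV, hxp, hxX', -⟩ := ptdata y hy
    have hq0 : 0 ≤ gradSqAt G (fun z ↦ (1 - χ z) * N z) y := hG.gradSqAt_nonneg hyV (hpos y hyV) _
    have h := weight_interior_le (xf := xf) (y := y) hσ.le hx₀ hq0 hxp hxX'
      (fun hlt ↦ (van (hvan₂' y hy hlt).1 (hvan₂' y hy hlt).2).2.2.2.1) 4
    rw [← hW4] at h
    linarith [h]
  have s9e : wH₂ ≤ W8 * Hs₂ + 0 * Hs₂ + 0 * Hs₂ + 0 * Hs₂ := by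
    rw [hwH₂, hHs₂]
    refine integral_sqrtDetGram_le_of_pointwise₄ b μ S W8 0 0 0 IwH₂ IuH₂ IuH₂ IuH₂ IuH₂
      (fun y hy ↦ ?_) (fun y hy ↦ by rw [(van₂ y hy).2.2.2.2.1]; simp)
    obtain ⟨hyV, hxp, hxX', -⟩ := ptdata y hy
    have hq0 : 0 ≤ normSqAt G y (hessAt G (fun z ↦ (1 - χ z) * N z) y) :=
      normSqAt_nonneg_of_pos hG hyV (hpos y hyV) _
    have h := weight_interior_le (xf := xf) (y := y) hσ.le hx₀ hq0 hxp hxX'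
      (fun hlt ↦ (van (hvan₂' y hy hlt).1 (hvan₂' y hy hlt).2).2.2.2.2.1) 8
    rw [← hW8] at h
    linarith [h]
  /- ── Step 9: nonnegativity of the quantities ────────────────────────────────────────── -/
  have nonneg : ∀ {k : E → ℝ}, (∀ y ∈ S, 0 ≤ k y) → (∀ y ∉ S, k y = 0) →
      0 ≤ ∫ y, sqrtDetGram G b y * k y ∂μ := by
    intro k hk hk0
    refine integral_nonneg fun y ↦ ?_
    show 0 ≤ sqrtDetGram G b y * k y
    by_cases hy : y ∈ S
    · exact mul_nonneg (Real.sqrt_nonneg _) (hk y hy)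
    · rw [hk0 y hy, mul_zero]
  have hVS : ∀ {y : E}, y ∈ S → y ∈ V := fun hy ↦ (ptdata _ hy).1
  have hwRK0 : 0 ≤ wRK := by
    rw [hwRK]
    exact nonneg (fun y hy ↦ by
      have := normSqAt_nonneg_of_pos hG (hVS hy) (hpos y (hVS hy)) (adjHamK G K N y + adjMomKS G Y y)
      positivity) (fun y hy ↦ by rw [(van₀ y hy).2.2.2.2.2.1, mul_zero])
  have hwRG0 : 0 ≤ wRG := by
    rw [hwRG]
    exact nonneg (fun y hy ↦ by
      have := normSqAt_nonneg_of_pos hG (hVS hy) (hpos y (hVS hy))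
        (adjHamG G K N y + adjMomGS G K Y y)
      positivity) (fun y hy ↦ by rw [(van₀ y hy).2.2.2.2.2.2, mul_zero])
  have hwRK₁0 : 0 ≤ wRK₁ := by
    rw [hwRK₁]
    exact nonneg (fun y hy ↦ by
      have := normSqAt_nonneg_of_pos hG (hVS hy) (hpos y (hVS hy))
        (adjHamK G K (fun z ↦ χ z * N z) y + adjMomKS G (fun z ↦ χ z • Y z) y)
      positivity) (fun y hy ↦ by rw [(van₁ y hy).2.2.2.2.2.1, mul_zero])
  have hwRG₁0 : 0 ≤ wRG₁ := by
    rw [hwRG₁]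
    exact nonneg (fun y hy ↦ by
      have := normSqAt_nonneg_of_pos hG (hVS hy) (hpos y (hVS hy))
        (adjHamG G K (fun z ↦ χ z * N z) y + adjMomGS G K (fun z ↦ χ z • Y z) y)
      positivity) (fun y hy ↦ by rw [(van₁ y hy).2.2.2.2.2.2, mul_zero])
  have hRK₂0 : 0 ≤ RK₂ := by
    rw [hRK₂]
    exact nonneg (fun y hy ↦ normSqAt_nonneg_of_pos hG (hVS hy) (hpos y (hVS hy)) _)
      (fun y hy ↦ (van₂ y hy).2.2.2.2.2.1)
  have hRG₂0 : 0 ≤ RG₂ := by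
    rw [hRG₂]
    exact nonneg (fun y hy ↦ normSqAt_nonneg_of_pos hG (hVS hy) (hpos y (hVS hy)) _)
      (fun y hy ↦ (van₂ y hy).2.2.2.2.2.2)
  have hNn₂0 : 0 ≤ Nn₂ := by
    rw [hNn₂]
    exact nonneg (fun y hy ↦ sq_nonneg _) (fun y hy ↦ (van₂ y hy).2.2.1)
  have hYy₂0 : 0 ≤ Yy₂ := by
    rw [hYy₂]
    exact nonneg (fun y hy ↦ by
      by_cases hz : (1 - χ y) • Y y = 0
      · rw [hz]; simp
      · exact (hpos y (hVS hy) _ hz).le) (fun y hy ↦ (van₂ y hy).1)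
  have hQ₂0 : 0 ≤ Q₂ := by
    rw [hQ₂]
    exact nonneg (fun y hy ↦ hG.mtrAt_bilinearComp_nonneg (hVS hy) (hpos y (hVS hy)) _)
      (fun y hy ↦ (van₂ y hy).2.1)
  have hDg₂0 : 0 ≤ Dg₂ := by
    rw [hDg₂]
    exact nonneg (fun y hy ↦ hG.gradSqAt_nonneg (hVS hy) (hpos y (hVS hy)) _)
      (fun y hy ↦ (van₂ y hy).2.2.2.1)
  have hNn0 : 0 ≤ Nn := by
    rw [hNn]
    exact nonneg (fun y hy ↦ sq_nonneg _) (fun y hy ↦ (van₀ y hy).2.2.1)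
  have hYy0 : 0 ≤ Yy := by
    rw [hYy]
    exact nonneg (fun y hy ↦ hY0 (hVS hy)) (fun y hy ↦ (van₀ y hy).1)
  have hDg0 : 0 ≤ Dg := by
    rw [hDg]
    exact nonneg (fun y hy ↦ hG.gradSqAt_nonneg (hVS hy) (hpos y (hVS hy)) _)
      (fun y hy ↦ (van₀ y hy).2.2.2.1)
  /- ── Step 10: the arithmetic ────────────────────────────────────────────────────────── -/
  set T : ℝ := wRK + wRG + Nn + Yy + Dg with hT
  have hT0 : 0 ≤ T := by positivity
  have hwRKT : wRK ≤ T := by rw [hT]; linarith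
  have hwRGT : wRG ≤ T := by rw [hT]; linarith
  have hNnT : Nn ≤ T := by rw [hT]; linarith
  have hYyT : Yy ≤ T := by rw [hT]; linarith
  have hDgT : Dg ≤ T := by rw [hT]; linarith
  -- piece 1
  have p1a : wYy₁ + wQq₁ + wNn₁ + wD₁ + wH₁ ≤ A₀' * (wRK₁ + wRG₁) :=
    iB.trans (mul_le_mul_of_nonneg_right (le_max_left _ _) (add_nonneg hwRK₁0 hwRG₁0))
  have p1b : wRK₁ + wRG₁ ≤ c1 * T := by
    have e1 : cK * Yy ≤ cK * T := mul_le_mul_of_nonneg_left hYyT hcK0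
    have e2 : cG1 * Nn ≤ cG1 * T := mul_le_mul_of_nonneg_left hNnT hcG10
    have e3 : cG2 * Dg ≤ cG2 * T := mul_le_mul_of_nonneg_left hDgT hcG20
    have e4 : cG3 * Yy ≤ cG3 * T := mul_le_mul_of_nonneg_left hYyT hcG30
    have e : c1 * T = 2 * T + 2 * T + cK * T + cG1 * T + cG2 * T + cG3 * T := by
      rw [hc1]; ring
    rw [e]
    linarith [s3, s4, e1, e2, e3, e4, hwRKT, hwRGT]
  have p1 : wYy₁ + wQq₁ + wNn₁ + wD₁ + wH₁ ≤ A₀' * (c1 * T) :=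
    p1a.trans (mul_le_mul_of_nonneg_left p1b hA₀'0)
  -- piece 2
  have p2a : Q₂ + Hs₂ + Dg₂ ≤ CB' * (RK₂ + RG₂ + Nn₂ + Yy₂) :=
    iI.trans (mul_le_mul_of_nonneg_right (le_max_left _ _) (by positivity))
  have p2b : RK₂ + RG₂ + Nn₂ + Yy₂ ≤ c2 * T := by
    have e1 : cx4 * wRK ≤ cx4 * T := mul_le_mul_of_nonneg_left hwRKT hcx40
    have e2 : cx8 * wRG ≤ cx8 * T := mul_le_mul_of_nonneg_left hwRGT hcx80
    have e3 : dK * Yy ≤ dK * T := mul_le_mul_of_nonneg_left hYyT hdK0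
    have e4 : dG1 * Nn ≤ dG1 * T := mul_le_mul_of_nonneg_left hNnT hdG10
    have e5 : dG2 * Dg ≤ dG2 * T := mul_le_mul_of_nonneg_left hDgT hdG20
    have e6 : dG3 * Yy ≤ dG3 * T := mul_le_mul_of_nonneg_left hYyT hdG30
    have e : c2 * T = cx4 * T + cx8 * T + dK * T + dG1 * T + dG2 * T + dG3 * T + 1 * T + 1 * T := by
      rw [hc2]; ring
    rw [e]
    linarith [s6, s7, s8a, s8b, e1, e2, e3, e4, e5, e6, hNnT, hYyT]
  have p2c : Q₂ + Hs₂ + Dg₂ ≤ CB' * (c2 * T) := p2a.trans (mul_le_mul_of_nonneg_left p2b hCB'0)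
  have p2d : W4 * Q₂ + W4 * Dg₂ + W8 * Hs₂ ≤ W8 * (CB' * (c2 * T)) := by
    have e1 : W4 * Q₂ ≤ W8 * Q₂ := mul_le_mul_of_nonneg_right hW48 hQ₂0
    have e2 : W4 * Dg₂ ≤ W8 * Dg₂ := mul_le_mul_of_nonneg_right hW48 hDg₂0
    have e3 : W8 * (Q₂ + Hs₂ + Dg₂) ≤ W8 * (CB' * (c2 * T)) := mul_le_mul_of_nonneg_left p2c hW80
    have e : W8 * (Q₂ + Hs₂ + Dg₂) = W8 * Q₂ + W8 * Hs₂ + W8 * Dg₂ := by ring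
    rw [e] at e3
    linarith [e1, e2, e3]
  have p2e : eW * Yy + eW * Nn ≤ eW * T + eW * T :=
    add_le_add (mul_le_mul_of_nonneg_left hYyT heW0) (mul_le_mul_of_nonneg_left hNnT heW0)
  have p2 : wYy₂ + wQq₂ + wNn₂ + wD₂ + wH₂ ≤ (eW * T + eW * T) + W8 * (CB' * (c2 * T)) := by
    linarith [s9a, s9b, s9c, s9d, s9e, p2d, p2e]
  -- conclusion
  have e : (2 * (A₀' * c1) + 2 * (eW + eW) + 2 * (W8 * (CB' * c2))) * T =
      2 * (A₀' * (c1 * T)) + 2 * ((eW * T + eW * T) + W8 * (CB' * (c2 * T))) := by ring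
  rw [e]
  linarith [s1a, s1b, s1c, s1d, s1e, p1, p2]

end MetricCoord

end Literature.Geometry.Lorentzian

end
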